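import Summits.PneNP.PneNP.Theorems.SoloInformedResBound
import Literature.Computability.MetaComplexity.RefutationCNFPolyTimeProofs
import HarnessLib

/-!
# `PneNP → RESBOUND ∉ P`, unconditionally

Soloist file (`solo-PneNP-informed`; landing prefix `SoloInformed`). The hypothesis
`rrefGadget_polyTime` ([AtseriasMuller2020, Thm 2]: the gadget `G(F) = RREF(F, 13n²)` is
polynomial-time computable) of `SoloInformedResBound.lean` is now a theorem of the Literature
library (`rrefGadget_polyTime_holds`, `RefutationCNFPolyTimeProofs.lean`), so the proof-complexity
face of the summit holds outright:

* `soloInformed_kSAT_three_karpReducible_resBound_holds : 3SAT ≤ₚ RESBOUND`;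
* `soloInformed_resBound_isNPHard : IsNPHard RESBOUND` — deciding, given a CNF `F` and `1ˢ`,
  whether `F` has a Resolution refutation with at most `s` lines is NP-hard
  [AtseriasMuller2020, Thm 1, decision form];
* `soloInformed_resBound_not_mem_P_of_pneNP_holds : PneNP → RESBOUND ∉ P`;
* `soloInformed_pneNP_iff_resBound_not_mem_P_holds : RESBOUND ∈ NP → (PneNP ↔ RESBOUND ∉ P)`
  (the membership `RESBOUND ∈ NP` — guess the refutation — is the only remaining routine input).

A kernel-checked sharpening of the summit STATEMENT (its automatability face), not progress toward
it. Refs: A. Atserias, M. Müller, *Automating Resolution is NP-hard*, J. ACM 67(5) (2020) Art. 31,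
Thms 1–2; S. Arora, B. Barak, *Computational Complexity* (2009), Thm. 2.8.
-/

namespace Summit.PneNP.PneNP.Theorems

open Literature.Computability.Complexity Literature.Computability.MetaComplexity
open _root_.Computability
open scoped Notation

/-- **`3SAT ≤ₚ RESBOUND`**, unconditionally. [cite: AtseriasMuller2020, Thm 1 and Thm 2] -/
theorem soloInformed_kSAT_three_karpReducible_resBound_holds : kSAT 3 ≤ₚ resBoundLang :=
  soloInformed_kSAT_three_karpReducible_resBound rrefGadget_polyTime_holds

/-- **`RESBOUND` is NP-hard**: bounded Resolution proof search (given `F` and `1ˢ`, is there a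
refutation of `F` with at most `s` lines?) is NP-hard under Karp reductions.
[cite: AtseriasMuller2020, Thm 1] [cite: AroraBarak2009, Thm. 2.8] -/
theorem soloInformed_resBound_isNPHard : IsNPHard resBoundLang :=
  IsHard.of_reducible_holds isNPComplete_kSAT_three_holds.isHard
    soloInformed_kSAT_three_karpReducible_resBound_holds

/-- **`RESBOUND ∈ P ⟹ NP ⊆ P`**, unconditionally. [cite: AtseriasMuller2020, Thm 1] -/
theorem soloInformed_NP_subset_P_of_resBound_mem_P_holds (hP : resBoundLang ∈ Classes.P) :
    Nondeterministic.NP ⊆ Classes.P :=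
  soloInformed_NP_subset_P_of_resBound_mem_P rrefGadget_polyTime_holds hP

/-- **`PneNP → RESBOUND ∉ P`**, unconditionally: if `P ≠ NP` then no polynomial-time algorithm
decides bounded Resolution proof search. [cite: AtseriasMuller2020, Thm 1] -/
theorem soloInformed_resBound_not_mem_P_of_pneNP_holds (h : PneNP) : resBoundLang ∉ Classes.P :=
  soloInformed_resBound_not_mem_P_of_pneNP rrefGadget_polyTime_holds h

/-- **`PneNP ↔ RESBOUND ∉ P`** given only `RESBOUND ∈ NP`. [cite: AtseriasMuller2020, Thm 1] -/
theorem soloInformed_pneNP_iff_resBound_not_mem_P_holds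
    (hNP : resBoundLang ∈ Nondeterministic.NP) : PneNP ↔ resBoundLang ∉ Classes.P :=
  soloInformed_pneNP_iff_resBound_not_mem_P rrefGadget_polyTime_holds hNP

end Summit.PneNP.PneNP.Theorems
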